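import Summits.RiemannHypothesis.RiemannHypothesis.Theorems.PfPersistenceFibrewiseCoconvex
import Summits.RiemannHypothesis.RiemannHypothesis.Theorems.PfPersistenceHeightLocality
import HarnessLib

/-!
# PF persistence — EXACT MULTI-DIAL MATCHING BY PRIME DIALS for affine readers (pub-rhpf, cand-6 gen 3, part 3)

**HONEST FRAMING. This is a long-odds MECHANISM SEARCH; no RH claims.** Every statement below is RH-free
bookkeeping about the cell's observatory records (truncated Weil matrices of weight tables); nothing here bears
on the truth of RH. Labels: PROVED = kernel-checked here or in the imported tree files.

RULING A42 RETURNED the "multi-dial matching" closure argument for readers of finitely many numbers as a dimension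
count and had it TYPED as the explicit hypothesis `ExactMultiDialMatching F` (`PfPersistenceDialMatching`: some
composite of PRIME dials of `ζ`, `≠ ζ` as a datum, with exactly `ζ`'s readings and detectably negative), proved
there only for readers of bounded height. `PfPersistenceAffineMatching` proved matching free for AFFINE data with
witnesses at prime-power positions `2^{(J+1)3^j}`. This file redoes that construction at PRIME positions and so
DISCHARGES THE TYPED HYPOTHESIS for every reader factoring through finitely many affine coordinates `Φ` and the
matrices at finitely many windows `W`:

* §1 a sequence of primes `p₀ < p₁ < ⋯` beyond any bound with `p_{j+1} > p_j²` (Euclid, iterated);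
* §2 bookkeeping: a composite of dials at distinct positions rescales each position once;
* §3 `exists_primeDial_twoSided_matching` (PROVED): a line `ζ + t v`, `v` supported on `|ι| + 1` such primes beyond
  the reach of `W`, every point of which is a composite of PRIME DIALS of `ζ` with the same `Φ` and the same matrices
  on `W` as `ζ`, detectably negative and `≠ ζ` at two parameters of opposite signs (UP window `a = ¾ log p`, `N = 0`;
  DOWN window `a = log p`, `N = 1`, at the smallest active prime `p`);
* §4 `exactMultiDialMatching_of_windowsAffine` / `_of_affine` / `_linearMap` / `_functionals` (PROVED): the A42
  hypothesis holds OUTRIGHT for these readers — no Jacobian, no rank hypothesis, no DATA; corollary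
  `FactorsThrough.not_separates_of_windowsAffine` on any domain `⊇ arithDialSpace`.

Scope, honestly: the dial factors `K_j = 1 + t y_j / ζ(p_j)` are unrestricted reals (sign-reversed weights allowed),
at primes far beyond the served windows — `arithDialSpace` AS TYPED, outside the served dial menu. Readers of
eigenvalue magnitudes or other NONLINEAR functionals at infinitely many windows are NOT covered (A42 tolerance
matching, modulo `DialReady`, remains their handle).
-/

set_option linter.dupNamespace false  -- the mandated namespace repeats `RiemannHypothesis`

noncomputable section

open Real Finset Matrix

namespace Summit.RiemannHypothesis.RiemannHypothesis.Theorems.PfPersistence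

/-! ## §1 Fast-growing prime sequences -/

/-- PROVED: beyond any bound there is a sequence of primes, each exceeding the square of its predecessor. [folklore] -/
theorem exists_primeSeq (B : ℕ) :
    ∃ p : ℕ → ℕ, (∀ j, (p j).Prime) ∧ B < p 0 ∧ ∀ j, p j ^ 2 < p (j + 1) := by
  choose f hf using fun n : ℕ => Nat.exists_infinite_primes (n + 1)
  refine ⟨fun j => Nat.rec (motive := fun _ => ℕ) (f B) (fun _ q => f (q ^ 2)) j, fun j => ?_, (hf B).1,
    fun j => (hf _).1⟩
  cases j with
  | zero => exact (hf B).2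
  | succ j => exact (hf _).2

/-! ## §2 Composites of dials at distinct positions -/

/-- PROVED: a composite of dials leaves every position it does not touch unchanged. [folklore] -/
theorem multiDial_map_apply_of_forall_ne {α : Type*} (pos : α → ℕ) (K : α → ℝ) (w : Weights) (q : ℕ) :
    ∀ l : List α, (∀ j ∈ l, pos j ≠ q) → multiDial (l.map fun j => (pos j, K j)) w q = w q
  | [], _ => rfl
  | j :: l, h => by
      have hj : pos j ≠ q := h j (by simp)
      have ih := multiDial_map_apply_of_forall_ne pos K w q l fun i hi => h i (by simp [hi])
      show (if q = pos j then K j * multiDial (l.map fun j => (pos j, K j)) w q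
        else multiDial (l.map fun j => (pos j, K j)) w q) = w q
      rw [if_neg fun h' => hj h'.symm, ih]

/-- PROVED: a composite of dials at pairwise distinct positions rescales each touched position exactly once. [folklore] -/
theorem multiDial_map_apply_of_mem {α : Type*} (pos : α → ℕ) (K : α → ℝ) (w : Weights)
    (hinj : Function.Injective pos) :
    ∀ l : List α, l.Nodup → ∀ j₀ ∈ l, multiDial (l.map fun j => (pos j, K j)) w (pos j₀) = K j₀ * w (pos j₀)
  | [], _, j₀, hj₀ => absurd hj₀ (by simp)
  | j :: l, hnd, j₀, hj₀ => by
      rw [List.nodup_cons] at hnd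
      show (if pos j₀ = pos j then K j * multiDial (l.map fun j => (pos j, K j)) w (pos j₀)
        else multiDial (l.map fun j => (pos j, K j)) w (pos j₀)) = K j₀ * w (pos j₀)
      rcases List.mem_cons.1 hj₀ with h | h
      · subst h
        rw [if_pos rfl, multiDial_map_apply_of_forall_ne pos K w (pos j₀) l]
        intro i hi heq
        have := hinj heq
        subst this
        exact hnd.1 hi
      · have hne : pos j₀ ≠ pos j := by
          intro heq
          have := hinj heq
          subst this
          exact hnd.1 h
        rw [if_neg hne]
        exact multiDial_map_apply_of_mem pos K w hinj l hnd.2 j₀ h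

/-! ## §3 The matching line through `ζ` made of prime dials -/

/-- **PROVED — EXACT MATCHING BY PRIME DIALS IS FREE FOR AFFINE DATA.** For finitely many affine coordinates `Φ`
and finitely many windows `W` there is a direction `v` (supported on `|ι| + 1` primes beyond the reach of `W`, each
exceeding the square of the previous one) such that every point of the line `ζ + t v` is a composite of PRIME
DIALS of `ζ` with the SAME `Φ` and the SAME matrices on `W` as `ζ`, and two parameters of OPPOSITE signs at which
the datum is `≠ ζ` and DETECTABLY NEGATIVE. [folklore] -/
theorem exists_primeDial_twoSided_matching {ι : Type*} [Fintype ι] (Φ : Datum →ₗ[ℝ] (ι → ℝ))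
    (W : Finset Window) :
    ∃ v : Weights, ∃ t₁ t₂ : ℝ, t₁ * t₂ < 0 ∧
      (∀ t : ℝ, ∃ L : List (ℕ × ℝ), (∀ pk ∈ L, pk.1.Prime) ∧
        multiDial L zetaWeights = zetaWeights + t • v) ∧
      (∀ t : ℝ, Φ (datumOf (zetaWeights + t • v)) = Φ zetaDatum) ∧
      (∀ t : ℝ, ∀ win ∈ W, datumOf (zetaWeights + t • v) win = zetaDatum win) ∧
      datumOf (zetaWeights + t₁ • v) ≠ zetaDatum ∧ DetectablyNegative (datumOf (zetaWeights + t₁ • v)) ∧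
      datumOf (zetaWeights + t₂ • v) ≠ zetaDatum ∧ DetectablyNegative (datumOf (zetaWeights + t₂ • v)) := by
  classical
  obtain ⟨m, hm⟩ : ∃ m : ℕ, m = Fintype.card ι + 1 := ⟨_, rfl⟩
  -- primes beyond the reach of every window of `W`, each exceeding the square of the previous one
  obtain ⟨p, hprime, hB, hsq⟩ := exists_primeSeq (∑ w ∈ W, ⌈Real.exp (2 * w.a)⌉₊)
  have hp2 : ∀ j, (2 : ℝ) ≤ p j := fun j => by exact_mod_cast (hprime j).two_le
  have hppos : ∀ j, (0 : ℝ) < p j := fun j => by linarith [hp2 j]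
  have hlogpos : ∀ j, 0 < Real.log (p j) := fun j => Real.log_pos (by linarith [hp2 j])
  have hlt : ∀ j, p j < p (j + 1) := fun j =>
    lt_of_le_of_lt (Nat.le_self_pow two_ne_zero _) (hsq j)
  have hmono : StrictMono p := strictMono_nat_of_lt_succ hlt
  have hsq' : ∀ j j' : ℕ, j < j' → p j ^ 2 < p j' := fun j j' h =>
    lt_of_lt_of_le (hsq j) (hmono.monotone (Nat.succ_le_of_lt h))
  have hW : ∀ win ∈ W, ∀ j : ℕ, 2 * win.a < Real.log (p j) := by
    intro win hwin j
    rw [Real.lt_log_iff_exp_lt (hppos j)]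
    have h1 : Real.exp (2 * win.a) ≤ (⌈Real.exp (2 * win.a)⌉₊ : ℝ) := Nat.le_ceil _
    have h2 : (⌈Real.exp (2 * win.a)⌉₊ : ℝ) ≤ ((∑ w ∈ W, ⌈Real.exp (2 * w.a)⌉₊ : ℕ) : ℝ) := by
      exact_mod_cast Finset.single_le_sum (f := fun w : Window => ⌈Real.exp (2 * w.a)⌉₊)
        (fun _ _ => Nat.zero_le _) hwin
    have h3 : ((∑ w ∈ W, ⌈Real.exp (2 * w.a)⌉₊ : ℕ) : ℝ) < p j := by
      exact_mod_cast lt_of_lt_of_le hB (hmono.monotone (Nat.zero_le j))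
    linarith
  have hinj : Function.Injective fun j : Fin m => p j.val := fun j j' h =>
    Fin.ext (hmono.injective h)
  -- the multi-position table and the prime-block map, as linear maps
  let V : (Fin m → ℝ) →ₗ[ℝ] Weights :=
    { toFun := fun y q => ∑ j : Fin m, if p j.val = q then y j else 0
      map_add' := by
        intro y y'
        funext q
        rw [Pi.add_apply, ← Finset.sum_add_distrib]
        refine Finset.sum_congr rfl fun j _ => ?_
        split_ifs <;> simp
      map_smul' := by
        intro c y
        funext q
        rw [Pi.smul_apply, smul_eq_mul, RingHom.id_apply, Finset.mul_sum]
        refine Finset.sum_congr rfl fun j _ => ?_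
        split_ifs <;> simp }
  have hV : ∀ y : Fin m → ℝ, ∀ q : ℕ, V y q = ∑ j : Fin m, if p j.val = q then y j else 0 :=
    fun _ _ => rfl
  have hVpos : ∀ (y : Fin m → ℝ) (j : Fin m), V y (p j.val) = y j := by
    intro y j
    rw [hV, Finset.sum_eq_single j]
    · rw [if_pos rfl]
    · intro j' _ hne
      rw [if_neg fun h => hne (hinj h)]
    · intro h
      exact absurd (Finset.mem_univ j) h
  have hVoff : ∀ (y : Fin m → ℝ) (q : ℕ), (∀ j : Fin m, p j.val ≠ q) → V y q = 0 := by
    intro y q hq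
    rw [hV]
    exact Finset.sum_eq_zero fun j _ => if_neg (hq j)
  let P : Weights →ₗ[ℝ] Datum :=
    { toFun := fun v win => primesBlock v win
      map_add' := by
        intro u v
        funext win
        exact primesBlock_add u v win
      map_smul' := by
        intro c v
        funext win
        rw [RingHom.id_apply, Pi.smul_apply]
        exact primesBlock_smul c v win }
  have hP : ∀ v : Weights, ∀ win : Window, P v win = primesBlock v win := fun _ _ => rfl
  obtain ⟨y, hy0, hψ⟩ :=
    exists_ne_zero_map_eq_zero (ι := ι) (by omega : Fintype.card ι < m) (Φ ∘ₗ P ∘ₗ V)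
  have hψ' : Φ (P (V y)) = 0 := by simpa using hψ
  have hd : ∀ t : ℝ, datumOf (zetaWeights + t • V y) = zetaDatum - t • P (V y) := by
    intro t
    funext w'
    rw [Pi.sub_apply, Pi.smul_apply, hP, datumOf_add_apply, primesBlock_smul]
    rfl
  -- a position whose logarithm exceeds `2a` is invisible at the window
  have hout : ∀ (win : Window) (j : Fin m), 2 * win.a < Real.log (p j.val) →
      p j.val ∉ primeRange (2 * win.a) := by
    intro win j hlt' hmemj
    have h1 := log_le_of_mem_primeRange (mul_pos two_pos win.ha).le hmemj
    linarith
  have hinv : ∀ win ∈ W, primesBlock (V y) win = 0 := by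
    intro win hwin
    ext n m'
    rw [primesBlock_apply, Matrix.zero_apply, Finset.sum_eq_zero, mul_zero]
    intro q hq
    rw [hVoff y q fun j h => hout win j (hW win hwin j.val) (h ▸ hq), zero_mul]
  -- the smallest ACTIVE prime `P₀ = p j₀`
  have hsupp : (Finset.univ.filter fun j : Fin m => y j ≠ 0).Nonempty := by
    by_contra h
    rw [Finset.not_nonempty_iff_eq_empty, Finset.filter_eq_empty_iff] at h
    exact hy0 (funext fun j => by simpa using h (Finset.mem_univ j))
  obtain ⟨j₀, hj₀mem, hj₀min⟩ :=
    Finset.exists_min_image (Finset.univ.filter fun j : Fin m => y j ≠ 0) (fun j => j.val) hsupp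
  have hyj₀ : y j₀ ≠ 0 := by simpa using hj₀mem
  have hmin : ∀ j : Fin m, j.val < j₀.val → y j = 0 := by
    intro j hj
    by_contra hne
    have := hj₀min j (by simpa using hne)
    omega
  obtain ⟨P₀, hP₀⟩ : ∃ P₀ : ℕ, P₀ = p j₀.val := ⟨_, rfl⟩
  have hP₀pos : (0 : ℝ) < P₀ := hP₀ ▸ hppos _
  have hlogP₀ : 0 < Real.log P₀ := hP₀ ▸ hlogpos _
  -- at a window with `2a ≤ 2 log P₀`, the table `V y` is seen only through the position `P₀`
  have hVq : ∀ win : Window, 2 * win.a ≤ 2 * Real.log P₀ →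
      ∀ q ∈ primeRange (2 * win.a), q ≠ P₀ → V y q = 0 := by
    intro win hwin q hq hne
    rw [hV]
    refine Finset.sum_eq_zero fun j _ => ?_
    split_ifs with h
    · rcases lt_trichotomy j.val j₀.val with hlt' | heq | hgt
      · exact hmin j hlt'
      · exfalso
        apply hne
        rw [← h, heq, hP₀]
      · refine absurd (h ▸ hq) (hout win j ?_)
        have h2 : ((P₀ : ℝ)) ^ 2 < p j.val := by
          rw [hP₀]
          exact_mod_cast hsq' _ _ hgt
        have h3 : Real.log ((P₀ : ℝ) ^ 2) < Real.log (p j.val) := Real.log_lt_log (by positivity) h2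
        rw [Real.log_pow] at h3
        push_cast at h3
        linarith
    · rfl
  have hVk : V y P₀ = y j₀ := by
    rw [hP₀]
    exact hVpos y j₀
  have hsum : ∀ win : Window, 2 * win.a ≤ 2 * Real.log P₀ → P₀ ∈ primeRange (2 * win.a) →
      ∀ θ : ℝ → ℝ, (∑ q ∈ primeRange (2 * win.a), V y q * θ (Real.log q)) = y j₀ * θ (Real.log P₀) := by
    intro win hwin hmem θ
    rw [Finset.sum_eq_single P₀]
    · rw [hVk]
    · intro q hq hne
      rw [hVq win hwin q hq hne, zero_mul]
    · intro h
      exact absurd hmem h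
  -- UP window `a = ¾ log P₀`, `N = 0`, entry `(0,0)`: `θ₀₀ = 1/3`, slope `2y/3`
  have hau : 0 < 3 * Real.log P₀ / 4 := by positivity
  obtain ⟨wu, hwu⟩ : ∃ win : Window, win = ⟨3 * Real.log P₀ / 4, 0, hau⟩ := ⟨_, rfl⟩
  have hwua : 2 * wu.a = 3 * Real.log P₀ / 2 := by
    rw [hwu]
    ring
  have hwu3 : 2 * wu.a ≤ 2 * Real.log P₀ := by
    rw [hwua]
    linarith
  have hmemu : P₀ ∈ primeRange (2 * wu.a) := by
    apply mem_primeRange_of_log_le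
    rw [hwua]
    linarith
  have hθu : thetaEven (2 * wu.a) 0 0 (Real.log P₀) = 1 / 3 := by
    rw [thetaEven_zero_zero, hwua]
    field_simp
    ring
  have hPu : primesBlock (V y) wu 0 0 = 2 * (y j₀ * (1 / 3)) := by
    rw [primesBlock_apply, Fin.val_zero, hsum wu hwu3 hmemu, hθu]
  -- DOWN window `a = log P₀`, `N = 1`, entry `(1,1)`: `θ₁₁(log P₀) = −1/2`, slope `−y`
  obtain ⟨wd, hwd⟩ : ∃ win : Window, win = ⟨Real.log P₀, 1, hlogP₀⟩ := ⟨_, rfl⟩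
  have hwda : 2 * wd.a = 2 * Real.log P₀ := by rw [hwd]
  have hmemd : P₀ ∈ primeRange (2 * wd.a) := by
    apply mem_primeRange_of_log_le
    rw [hwda]
    linarith
  have hθd : thetaEven (2 * wd.a) ((1 : Fin (wd.N + 1)) : ℕ) ((1 : Fin (wd.N + 1)) : ℕ)
      (Real.log P₀) = -(1 / 2) := by
    rw [hwd]
    exact thetaEven_one_one_self hlogP₀.ne'
  have hPd : primesBlock (V y) wd 1 1 = 2 * (y j₀ * -(1 / 2)) := by
    rw [primesBlock_apply, hsum wd hwda.le hmemd, hθd]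
  -- the two parameters
  obtain ⟨cu, hcu⟩ : ∃ c : ℝ, c = datumOf zetaWeights wu 0 0 := ⟨_, rfl⟩
  obtain ⟨cd, hcd⟩ : ∃ c : ℝ, c = datumOf zetaWeights wd 1 1 := ⟨_, rfl⟩
  have hsu : 2 * (y j₀ * (1 / 3 : ℝ)) ≠ 0 := mul_ne_zero two_ne_zero (mul_ne_zero hyj₀ (by norm_num))
  have hsd : 2 * (y j₀ * -(1 / 2 : ℝ)) ≠ 0 := mul_ne_zero two_ne_zero (mul_ne_zero hyj₀ (by norm_num))
  obtain ⟨tu, htu⟩ : ∃ t : ℝ, t = (|cu| + 1) / (2 * (y j₀ * (1 / 3))) := ⟨_, rfl⟩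
  obtain ⟨td, htd⟩ : ∃ t : ℝ, t = (|cd| + 1) / (2 * (y j₀ * -(1 / 2))) := ⟨_, rfl⟩
  have htus : tu * (2 * (y j₀ * (1 / 3))) = |cu| + 1 := by
    rw [htu, div_mul_cancel₀ _ hsu]
  have htds : td * (2 * (y j₀ * -(1 / 2))) = |cd| + 1 := by
    rw [htd, div_mul_cancel₀ _ hsd]
  have hentu : datumOf (zetaWeights + tu • V y) wu 0 0 = cu - (|cu| + 1) := by
    rw [datumOf_add_apply, Matrix.sub_apply, primesBlock_smul, Matrix.smul_apply, smul_eq_mul, hPu,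
      htus, ← hcu]
  have hentd : datumOf (zetaWeights + td • V y) wd 1 1 = cd - (|cd| + 1) := by
    rw [datumOf_add_apply, Matrix.sub_apply, primesBlock_smul, Matrix.smul_apply, smul_eq_mul, hPd,
      htds, ← hcd]
  have hsign : tu * td < 0 := by
    have hprod : tu * td * ((2 * (y j₀ * (1 / 3))) * (2 * (y j₀ * -(1 / 2))))
        = (|cu| + 1) * (|cd| + 1) := by
      rw [← htus, ← htds]
      ring
    have hneg : (2 * (y j₀ * (1 / 3 : ℝ))) * (2 * (y j₀ * -(1 / 2))) < 0 := by
      have hy2 : 0 < y j₀ * y j₀ := mul_self_pos.2 hyj₀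
      nlinarith
    have hpos : 0 < (|cu| + 1) * (|cd| + 1) := by positivity
    have h := div_neg_of_pos_of_neg hpos hneg
    rw [← hprod, mul_div_assoc, div_self hneg.ne, mul_one] at h
    exact h
  refine ⟨V y, tu, td, hsign, ?_, ?_, ?_, ?_, ?_, ?_, ?_⟩
  · -- every point of the line is a composite of prime dials of `ζ`
    intro t
    refine ⟨(List.finRange m).map fun j => (p j.val, 1 + t * y j / zetaWeights (p j.val)), ?_, ?_⟩
    · intro pk hpk
      rw [List.mem_map] at hpk
      obtain ⟨j, -, rfl⟩ := hpk
      exact hprime _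
    · funext q
      rw [Pi.add_apply, Pi.smul_apply, smul_eq_mul]
      by_cases hq : ∃ j : Fin m, p j.val = q
      · obtain ⟨j, rfl⟩ := hq
        rw [multiDial_map_apply_of_mem (fun j : Fin m => p j.val) (fun j => 1 + t * y j / zetaWeights (p j.val))
          zetaWeights hinj (List.finRange m) (List.nodup_finRange m) j (List.mem_finRange j), hVpos]
        have hz : zetaWeights (p j.val) ≠ 0 := (zetaWeights_pos_of_prime (hprime _)).ne'
        field_simp
      · rw [multiDial_map_apply_of_forall_ne (fun j : Fin m => p j.val)
          (fun j => 1 + t * y j / zetaWeights (p j.val)) zetaWeights q (List.finRange m)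
          (fun j _ h => hq ⟨j, h⟩), hVoff y q fun j h => hq ⟨j, h⟩, mul_zero, add_zero]
  · -- the affine coordinates are constant along the line
    intro t
    rw [hd, map_sub, map_smul, hψ', smul_zero, sub_zero]
  · -- the matrices on `W` are constant along the line
    intro t w' hw'
    rw [datumOf_add_apply, primesBlock_smul, hinv w' hw', smul_zero, sub_zero]
    rfl
  · intro h
    have h'' : datumOf (zetaWeights + tu • V y) wu 0 0 = datumOf zetaWeights wu 0 0 := by rw [h]; rfl
    rw [hentu, ← hcu] at h''
    linarith [abs_nonneg cu]
  · refine ⟨wu, Pi.single 0 1, ?_⟩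
    rw [single_zero_rayleigh, hentu]
    linarith [le_abs_self cu]
  · intro h
    have h'' : datumOf (zetaWeights + td • V y) wd 1 1 = datumOf zetaWeights wd 1 1 := by rw [h]; rfl
    rw [hentd, ← hcd] at h''
    linarith [abs_nonneg cd]
  · refine ⟨wd, Pi.single 1 1, ?_⟩
    rw [single_rayleigh, hentd]
    linarith [le_abs_self cd]

/-! ## §4 The A42 hypothesis discharged for affine readers -/

/-- **PROVED — `ExactMultiDialMatching` for every reader of (`Φ`, the matrices on `W`).** A reader whose value is
determined by finitely many affine coordinates and the matrices at finitely many windows is EXACTLY matched by a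
composite of prime dials of `ζ` that is detectably negative: RULING A42's typed hypothesis, as a theorem, for this
class — no Jacobian, no rank hypothesis, no DATA. [folklore] -/
theorem exactMultiDialMatching_of_windowsAffine {ι : Type*} [Fintype ι] {ρ : Type} {F : Datum → ρ}
    (Φ : Datum →ₗ[ℝ] (ι → ℝ)) (W : Finset Window)
    (hF : ∀ d d' : Datum, Φ d = Φ d' → (∀ win ∈ W, d win = d' win) → F d = F d') :
    ExactMultiDialMatching F := by
  obtain ⟨v, t₁, t₂, -, hL, hΦ, hW, hne₁, hneg₁, -, -⟩ := exists_primeDial_twoSided_matching Φ W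
  obtain ⟨L, hLp, hLeq⟩ := hL t₁
  refine ⟨L, hLp, ?_, ?_, ?_⟩
  · rw [hLeq]
    exact hne₁
  · rw [hLeq]
    exact hF _ _ (hΦ t₁) (hW t₁)
  · rw [hLeq]
    exact hneg₁

/-- PROVED: `ExactMultiDialMatching` for every reader of finitely many affine coordinates. [folklore] -/
theorem exactMultiDialMatching_of_affine {ι : Type*} [Fintype ι] {ρ : Type} {F : Datum → ρ}
    (Φ : Datum →ₗ[ℝ] (ι → ℝ)) (hF : ∀ d d' : Datum, Φ d = Φ d' → F d = F d') :
    ExactMultiDialMatching F :=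
  exactMultiDialMatching_of_windowsAffine Φ ∅ fun d d' h _ => hF d d' h

/-- PROVED: every finite-rank LINEAR reader is exactly matched by prime dials of `ζ`. [folklore] -/
theorem exactMultiDialMatching_linearMap {ι : Type} [Fintype ι] (Φ : Datum →ₗ[ℝ] (ι → ℝ)) :
    ExactMultiDialMatching Φ :=
  exactMultiDialMatching_of_affine Φ fun _ _ h => h

/-- PROVED: finitely many linear functionals (the A42 shape `F : Datum → Fin k → ℝ`, affine case) are exactly
matched by prime dials of `ζ`. [folklore] -/
theorem exactMultiDialMatching_functionals {ι : Type} [Fintype ι] (φ : ι → (Datum →ₗ[ℝ] ℝ)) :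
    ExactMultiDialMatching (fun d i => φ i d) :=
  exactMultiDialMatching_linearMap (LinearMap.pi φ)

/-- PROVED (corollary, reader form of the cell's rows): a class factoring through a reader of (`Φ`, the matrices on
`W`) cannot separate `ζ` on any domain `⊇ arithDialSpace`. [folklore] -/
theorem FactorsThrough.not_separates_of_windowsAffine {ι : Type*} [Fintype ι] {ρ : Type} {S : Set Datum}
    {F : Datum → ρ} (hS : FactorsThrough S F) (Φ : Datum →ₗ[ℝ] (ι → ℝ)) (W : Finset Window)
    (hF : ∀ d d' : Datum, Φ d = Φ d' → (∀ win ∈ W, d win = d' win) → F d = F d')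
    {D : Set Datum} (hD : arithDialSpace ⊆ D) : ¬ Separates S D zetaDatum :=
  hS.not_separates_arith (exactMultiDialMatching_of_windowsAffine Φ W hF) hD

end Summit.RiemannHypothesis.RiemannHypothesis.Theorems.PfPersistence

end
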